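import Summits.NavierStokesRegularity.NavierStokesRegularity.Theorems.ExtremiserTransienceTwoThirdsDefs
import HarnessLib

/-!
# Route `ExtremiserTransience`, crux `NearExtremalTransiencePerFlow` (stmt-NavierStokesRegularity-26567),
# LINE g10-1 «two_thirds» (ns-idea-10), stub S1a′ — BRICK 2, lemma P3g: the `ρ`-BOOKKEEPING OF THE CELL CONSTANTS

`--supports stmt-NavierStokesRegularity-26567` (helper; prover seat ns-net-p2 g13).  Pure real arithmetic.  At scale `ρ ≥ 2` the cutoff sizes are
`k₁ = K₁/ρ⁷`, `k₂ = 2K₂/ρ¹⁴`, `k₃ = 6K₃/ρ²¹`, the gauge sizes `g₀ = a/ρ⁸`, `g₁ = a/ρ¹⁶`, `p₀ = aρ`, `p₁ = bρ⁴` (`a = C(A_E+5)`, `b = C(A₁+1)`,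
`…TwoThirdsPieceGauge`), the cell volume `vol B(c,2ρ⁸) ≤ 34ρ²⁴`, and the `L²` budgets `∫_{B(c,2ρ⁸)}‖w‖² ≤ 2A_Eρ⁸`, `∫‖Dψ‖² ≤ C A_E ρ⁸`.
This file bounds every combination entering the height, the gradient offset and the two `L²` offsets of a piece by `(constant)/ρ²`:
`div_pow_le_div_sq` (the one tool), `cell_height_const`, `cell_grad_const`, `cell_e1_consts`, `cell_e2_consts`, `volume_ball_two_rho_le`.
HONEST FRAMING: arithmetic; nothing about Navier–Stokes is proved; no summit is proved by a line. [folklore]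
-/

noncomputable section

open scoped Topology InnerProductSpace RealInnerProductSpace ENNReal NNReal ContDiff
open MeasureTheory Filter Set Metric
open Summit.NavierStokesRegularity.NavierStokesRegularity.Theorems.DepletionLadder.KStar.HalfSpace

namespace Summit.NavierStokesRegularity.NavierStokesRegularity.Theorems.NearExtremalTransiencePerFlow.TwoThirds

-- the summit's namespace repeats the problem name by convention (D-0017)
set_option linter.dupNamespace false

/-- The one tool: `X/ρⁿ ≤ X/ρ²` for `X ≥ 0`, `ρ ≥ 1`, `n ≥ 2`. [folklore] -/
theorem div_pow_le_div_sq {X ρ : ℝ} (hX : 0 ≤ X) (hρ : 1 ≤ ρ) {n : ℕ} (hn : 2 ≤ n) : X / ρ ^ n ≤ X / ρ ^ 2 :=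
  div_le_div_of_nonneg_left hX (by positivity) (pow_le_pow_right₀ hρ hn)

/-- `vol B(c, 2ρ⁸) ≤ 34 ρ²⁴` (and it is finite). [folklore] -/
theorem volume_ball_two_rho_le (c : E3) {ρ : ℝ} (hρ : 0 < ρ) :
    volume (ball c (2 * ρ ^ 8)) ≠ ⊤ ∧ (volume (ball c (2 * ρ ^ 8))).toReal ≤ 34 * ρ ^ 24 := by
  refine ⟨measure_ball_lt_top.ne, ?_⟩
  rw [EuclideanSpace.volume_ball_fin_three, ENNReal.toReal_mul, ENNReal.toReal_pow, ENNReal.toReal_ofReal (by positivity),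
    ENNReal.toReal_ofReal (by positivity)]
  have hπ : Real.pi ≤ 3.15 := Real.pi_lt_d2.le
  have h8 : 0 ≤ ρ ^ 24 := by positivity
  calc (2 * ρ ^ 8) ^ 3 * (Real.pi * 4 / 3) = (Real.pi * 32 / 3) * ρ ^ 24 := by ring
    _ ≤ 34 * ρ ^ 24 := mul_le_mul_of_nonneg_right (by linarith) h8

section Constants

variable {ρ a b cc K₁ K₂ K₃ A_E C : ℝ}

/-- Height constant: `g₀ + c k₁ p₀ ≤ (a + c K₁ a)/ρ²`. [folklore] -/
theorem cell_height_const (hρ : 2 ≤ ρ) (ha : 0 ≤ a) (hcc : 0 ≤ cc) (hK₁ : 0 ≤ K₁) :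
    a / ρ ^ 8 + cc * (K₁ / ρ ^ 7) * (a * ρ) ≤ (a + cc * K₁ * a) / ρ ^ 2 := by
  have hρ0 : 0 < ρ := by linarith
  have hρ1 : 1 ≤ ρ := by linarith
  have e : cc * (K₁ / ρ ^ 7) * (a * ρ) = (cc * K₁ * a) / ρ ^ 6 := by field_simp
  rw [e, add_div]
  exact add_le_add (div_pow_le_div_sq ha hρ1 (by norm_num)) (div_pow_le_div_sq (by positivity) hρ1 (by norm_num))

/-- Gradient-offset constant: `k₁ + g₁ + k₁g₀ + c(k₂p₀ + k₁p₁) ≤ (K₁ + a + K₁a + 2cK₂a + cK₁b)/ρ²`. [folklore] -/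
theorem cell_grad_const (hρ : 2 ≤ ρ) (ha : 0 ≤ a) (hb : 0 ≤ b) (hcc : 0 ≤ cc) (hK₁ : 0 ≤ K₁) (hK₂ : 0 ≤ K₂) :
    K₁ / ρ ^ 7 + a / ρ ^ 16 + K₁ / ρ ^ 7 * (a / ρ ^ 8) + cc * (2 * K₂ / (ρ ^ 7) ^ 2 * (a * ρ) + K₁ / ρ ^ 7 * (b * ρ ^ 4)) ≤
      (K₁ + a + K₁ * a + 2 * cc * K₂ * a + cc * K₁ * b) / ρ ^ 2 := by
  have hρ0 : 0 < ρ := by linarith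
  have hρ1 : 1 ≤ ρ := by linarith
  have e1 : K₁ / ρ ^ 7 * (a / ρ ^ 8) = (K₁ * a) / ρ ^ 15 := by field_simp
  have e2 : cc * (2 * K₂ / (ρ ^ 7) ^ 2 * (a * ρ) + K₁ / ρ ^ 7 * (b * ρ ^ 4)) = (2 * cc * K₂ * a) / ρ ^ 13 + (cc * K₁ * b) / ρ ^ 3 := by
    field_simp
  have i1 : K₁ / ρ ^ 7 ≤ K₁ / ρ ^ 2 := div_pow_le_div_sq hK₁ hρ1 (by norm_num)
  have i2 : a / ρ ^ 16 ≤ a / ρ ^ 2 := div_pow_le_div_sq ha hρ1 (by norm_num)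
  have i3 : K₁ * a / ρ ^ 15 ≤ K₁ * a / ρ ^ 2 := div_pow_le_div_sq (by positivity) hρ1 (by norm_num)
  have i4 : 2 * cc * K₂ * a / ρ ^ 13 ≤ 2 * cc * K₂ * a / ρ ^ 2 := div_pow_le_div_sq (by positivity) hρ1 (by norm_num)
  have i5 : cc * K₁ * b / ρ ^ 3 ≤ cc * K₁ * b / ρ ^ 2 := div_pow_le_div_sq (by positivity) hρ1 (by norm_num)
  rw [e1, e2, add_div, add_div, add_div, add_div]
  linarith only [i1, i2, i3, i4, i5]

/-- `e₁` constants: the constant term squared against the cell volume, and the two coefficient terms against the `L²` budgets. [folklore] -/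
theorem cell_e1_consts (hρ : 2 ≤ ρ) (ha : 0 ≤ a) (hcc : 0 ≤ cc) (hK₁ : 0 ≤ K₁) (hK₂ : 0 ≤ K₂) (hAE : 0 ≤ A_E) (hC : 0 ≤ C) :
    (cc * (K₁ / ρ ^ 7) * (a / ρ ^ 8) + cc * cc * (2 * K₂ / (ρ ^ 7) ^ 2) * (a * ρ)) ^ 2 * (34 * ρ ^ 24) ≤
        34 * (cc * K₁ * a + 2 * cc * cc * K₂ * a) ^ 2 / ρ ^ 2 ∧
      (cc * (K₁ / ρ ^ 7)) ^ 2 * (A_E * (2 * ρ ^ 8)) ≤ 2 * cc ^ 2 * K₁ ^ 2 * A_E / ρ ^ 2 ∧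
      (cc * cc * (K₁ / ρ ^ 7)) ^ 2 * (C * A_E * ρ ^ 8) ≤ cc ^ 4 * K₁ ^ 2 * C * A_E / ρ ^ 2 := by
  have hρ0 : 0 < ρ := by linarith
  have hρ1 : 1 ≤ ρ := by linarith
  refine ⟨?_, ?_, ?_⟩
  · -- the constant term: `α ≤ α₀/ρ¹³`, so `α²·34ρ²⁴ ≤ 34α₀²/ρ²`
    have e : cc * (K₁ / ρ ^ 7) * (a / ρ ^ 8) + cc * cc * (2 * K₂ / (ρ ^ 7) ^ 2) * (a * ρ) =
        (cc * K₁ * a) / ρ ^ 15 + (2 * cc * cc * K₂ * a) / ρ ^ 13 := by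
      field_simp
    have hle : cc * (K₁ / ρ ^ 7) * (a / ρ ^ 8) + cc * cc * (2 * K₂ / (ρ ^ 7) ^ 2) * (a * ρ) ≤ (cc * K₁ * a + 2 * cc * cc * K₂ * a) / ρ ^ 13 := by
      rw [e, add_div]
      exact add_le_add (div_le_div_of_nonneg_left (by positivity) (by positivity) (pow_le_pow_right₀ hρ1 (by norm_num))) le_rfl
    have h0 : 0 ≤ cc * (K₁ / ρ ^ 7) * (a / ρ ^ 8) + cc * cc * (2 * K₂ / (ρ ^ 7) ^ 2) * (a * ρ) := by positivity
    have hsq : (cc * (K₁ / ρ ^ 7) * (a / ρ ^ 8) + cc * cc * (2 * K₂ / (ρ ^ 7) ^ 2) * (a * ρ)) ^ 2 ≤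
        ((cc * K₁ * a + 2 * cc * cc * K₂ * a) / ρ ^ 13) ^ 2 := pow_le_pow_left₀ h0 hle 2
    have e2 : ((cc * K₁ * a + 2 * cc * cc * K₂ * a) / ρ ^ 13) ^ 2 * (34 * ρ ^ 24) = 34 * (cc * K₁ * a + 2 * cc * cc * K₂ * a) ^ 2 / ρ ^ 2 := by
      field_simp
    calc _ ≤ ((cc * K₁ * a + 2 * cc * cc * K₂ * a) / ρ ^ 13) ^ 2 * (34 * ρ ^ 24) := mul_le_mul_of_nonneg_right hsq (by positivity)
      _ = _ := e2
  · have e : (cc * (K₁ / ρ ^ 7)) ^ 2 * (A_E * (2 * ρ ^ 8)) = (2 * cc ^ 2 * K₁ ^ 2 * A_E) / ρ ^ 6 := by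
      field_simp
    rw [e]; exact div_pow_le_div_sq (by positivity) hρ1 (by norm_num)
  · have e : (cc * cc * (K₁ / ρ ^ 7)) ^ 2 * (C * A_E * ρ ^ 8) = (cc ^ 4 * K₁ ^ 2 * C * A_E) / ρ ^ 6 := by
      field_simp
    rw [e]; exact div_pow_le_div_sq (by positivity) hρ1 (by norm_num)

/-- `e₂` constants: the constant term squared against the cell volume and the five coefficient terms against their budgets. [folklore] -/
theorem cell_e2_consts (hρ : 2 ≤ ρ) (ha : 0 ≤ a) (hcc : 0 ≤ cc) (hK₁ : 0 ≤ K₁) (hK₂ : 0 ≤ K₂) (hK₃ : 0 ≤ K₃) (hAE : 0 ≤ A_E) (hC : 0 ≤ C)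
    {Z₂ D₂ Z₄ : ℝ} (hZ₂ : 0 ≤ Z₂) (hD₂ : 0 ≤ D₂) (hZ₄ : 0 ≤ Z₄) :
    (cc * (2 * K₂ / (ρ ^ 7) ^ 2 * (a / ρ ^ 8) + K₁ / ρ ^ 7 * (a / ρ ^ 16)) + cc * cc * (6 * K₃ / (ρ ^ 7) ^ 3) * (a * ρ)) ^ 2 *
          (34 * ρ ^ 24) ≤ 34 * (2 * cc * K₂ * a + cc * K₁ * a + 6 * cc * cc * K₃ * a) ^ 2 / ρ ^ 2 ∧
      (K₁ / ρ ^ 7) ^ 2 * Z₂ ≤ K₁ ^ 2 * Z₂ / ρ ^ 2 ∧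
      (cc * (2 * K₂ / (ρ ^ 7) ^ 2)) ^ 2 * (A_E * (2 * ρ ^ 8)) ≤ 8 * cc ^ 2 * K₂ ^ 2 * A_E / ρ ^ 2 ∧
      (cc * (K₁ / ρ ^ 7)) ^ 2 * D₂ ≤ cc ^ 2 * K₁ ^ 2 * D₂ / ρ ^ 2 ∧
      (2 * cc * cc * (2 * K₂ / (ρ ^ 7) ^ 2)) ^ 2 * (C * A_E * ρ ^ 8) ≤ 16 * cc ^ 4 * K₂ ^ 2 * C * A_E / ρ ^ 2 ∧
      (cc * cc * (K₁ / ρ ^ 7)) ^ 2 * (C * (Z₄ + A_E / ρ ^ 8)) ≤ cc ^ 4 * K₁ ^ 2 * C * (Z₄ + A_E) / ρ ^ 2 := by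
  have hρ0 : 0 < ρ := by linarith
  have hρ1 : 1 ≤ ρ := by linarith
  refine ⟨?_, ?_, ?_, ?_, ?_, ?_⟩
  · have e : cc * (2 * K₂ / (ρ ^ 7) ^ 2 * (a / ρ ^ 8) + K₁ / ρ ^ 7 * (a / ρ ^ 16)) + cc * cc * (6 * K₃ / (ρ ^ 7) ^ 3) * (a * ρ) =
        (2 * cc * K₂ * a) / ρ ^ 22 + (cc * K₁ * a) / ρ ^ 23 + (6 * cc * cc * K₃ * a) / ρ ^ 20 := by
      field_simp
    have hle : cc * (2 * K₂ / (ρ ^ 7) ^ 2 * (a / ρ ^ 8) + K₁ / ρ ^ 7 * (a / ρ ^ 16)) + cc * cc * (6 * K₃ / (ρ ^ 7) ^ 3) * (a * ρ) ≤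
        (2 * cc * K₂ * a + cc * K₁ * a + 6 * cc * cc * K₃ * a) / ρ ^ 13 := by
      rw [e, add_div, add_div]
      refine add_le_add (add_le_add ?_ ?_) ?_
      · exact div_le_div_of_nonneg_left (by positivity) (by positivity) (pow_le_pow_right₀ hρ1 (by norm_num))
      · exact div_le_div_of_nonneg_left (by positivity) (by positivity) (pow_le_pow_right₀ hρ1 (by norm_num))
      · exact div_le_div_of_nonneg_left (by positivity) (by positivity) (pow_le_pow_right₀ hρ1 (by norm_num))
    have h0 : 0 ≤ cc * (2 * K₂ / (ρ ^ 7) ^ 2 * (a / ρ ^ 8) + K₁ / ρ ^ 7 * (a / ρ ^ 16)) + cc * cc * (6 * K₃ / (ρ ^ 7) ^ 3) * (a * ρ) := by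
      positivity
    have hsq := pow_le_pow_left₀ h0 hle 2
    have e2 : ((2 * cc * K₂ * a + cc * K₁ * a + 6 * cc * cc * K₃ * a) / ρ ^ 13) ^ 2 * (34 * ρ ^ 24) =
        34 * (2 * cc * K₂ * a + cc * K₁ * a + 6 * cc * cc * K₃ * a) ^ 2 / ρ ^ 2 := by
      field_simp
    calc _ ≤ ((2 * cc * K₂ * a + cc * K₁ * a + 6 * cc * cc * K₃ * a) / ρ ^ 13) ^ 2 * (34 * ρ ^ 24) :=
          mul_le_mul_of_nonneg_right hsq (by positivity)
      _ = _ := e2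
  · have e : (K₁ / ρ ^ 7) ^ 2 * Z₂ = (K₁ ^ 2 * Z₂) / ρ ^ 14 := by
      field_simp
    rw [e]; exact div_pow_le_div_sq (by positivity) hρ1 (by norm_num)
  · have e : (cc * (2 * K₂ / (ρ ^ 7) ^ 2)) ^ 2 * (A_E * (2 * ρ ^ 8)) = (8 * cc ^ 2 * K₂ ^ 2 * A_E) / ρ ^ 20 := by
      field_simp
      ring
    rw [e]; exact div_pow_le_div_sq (by positivity) hρ1 (by norm_num)
  · have e : (cc * (K₁ / ρ ^ 7)) ^ 2 * D₂ = (cc ^ 2 * K₁ ^ 2 * D₂) / ρ ^ 14 := by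
      field_simp
    rw [e]; exact div_pow_le_div_sq (by positivity) hρ1 (by norm_num)
  · have e : (2 * cc * cc * (2 * K₂ / (ρ ^ 7) ^ 2)) ^ 2 * (C * A_E * ρ ^ 8) = (16 * cc ^ 4 * K₂ ^ 2 * C * A_E) / ρ ^ 20 := by
      field_simp
      ring
    rw [e]; exact div_pow_le_div_sq (by positivity) hρ1 (by norm_num)
  · have hin : Z₄ + A_E / ρ ^ 8 ≤ Z₄ + A_E := by
      have : A_E / ρ ^ 8 ≤ A_E := div_le_self hAE (one_le_pow₀ hρ1)
      linarith
    have e : (cc * cc * (K₁ / ρ ^ 7)) ^ 2 * (C * (Z₄ + A_E / ρ ^ 8)) = (cc ^ 4 * K₁ ^ 2 * C * (Z₄ + A_E / ρ ^ 8)) / ρ ^ 14 := by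
      field_simp
    rw [e]
    calc cc ^ 4 * K₁ ^ 2 * C * (Z₄ + A_E / ρ ^ 8) / ρ ^ 14 ≤ cc ^ 4 * K₁ ^ 2 * C * (Z₄ + A_E) / ρ ^ 14 := by
          exact div_le_div_of_nonneg_right (mul_le_mul_of_nonneg_left hin (by positivity)) (by positivity)
      _ ≤ _ := div_pow_le_div_sq (by positivity) hρ1 (by norm_num)

end Constants

end Summit.NavierStokesRegularity.NavierStokesRegularity.Theorems.NearExtremalTransiencePerFlow.TwoThirds

end
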